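import Literature.IUT.HodgeTheaters.FrobenioidBridgeEx54ivInfKappaArithCompat
import HarnessLib

/-!
# [IUTchI] Example 5.4 (iv), p. 149: non-vacuity companion of `FrobenioidBridgeEx54ivInfKappaArithCompat.lean`
# (GAP B item GB-12, PROOF-ONLY; cure of ERRATA-L5 I-128 per abc-iut-L5-lead RULINGS #346 (B), spec-keeper B
# FILE-DELTA 2026-08-28T21:54:23Z (iv) / 21:55:23Z (3)(α))

S. Mochizuki, *Inter-universal Teichmüller theory I*, kurims manuscript (May 2020), Example 5.4 (iv) p. 149
([IUTchI] Ex 5.4 (iv) p.149) [claim: Mochizuki2012, status: disputed] (D-0012 claim key, series status DISPUTED —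
three kernel facts about the cell's OWN typing; nothing of the series is asserted and no side is taken on
[IUTchIII] Cor. 3.12).

WHAT THIS CURES.  The module docstring of ★ p671638 says that ★ p514113's `PUnit` witness «cannot satisfy» the
realisation conjunct of `InitialThetaData.exists_infKappaLink_ex54ivInfKappaCompat_arith` (:281).  As TYPED that
exclusion remark over-claims: `PartialMul.IsRealizedBy.dom_eq : μ.dom = {p | ι p.1 * ι p.2 ∈ Set.range ι}`
(`ConventionsTemperoids.lean` :81–88) IS satisfied by a ONE-POINT carrier with EMPTY partial multiplication
(`dom := ∅`, `ι pt :=` a non-constant unit `X`, since `X·X ∉ {X}`), at which the clause holds as at ★ p514113 (clause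
(c) vacuous).  The theorem :281 is correct («satisfiable with non-constant realised mass»); only the remark needed one
more conjunct.  Here:

* `PartialMul.IsRealizedBy.apply_eq_one_of_subsingleton` — a one-point pseudo-monoid with NON-EMPTY domain realised
  in an abelian group realises only `1` (so, with a value outside the constants, the carrier has ≥ 2 points:
  `PartialMul.IsRealizedBy.nontrivial_of_dom_nonempty`);
* `CriticalLocus.one_mem_minfkSet` — `1 ∈ 𝕄_{∞κ}` (GB-01's `one_mem_infKappaCoricSetIn` at the geometric constants),
  so at the arithmetic knit `(1, 1)` inhabits the domain of `†𝕄^⊛_{∞κ}`;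
* `InitialThetaData.exists_infKappaLink_ex54ivInfKappaCompat_arith'` — the NV corollary WITH the conjunct
  `(L.globInfk Z).pm.dom.Nonempty` in front of the realisation conjunct (spec-keeper B's FILE-DELTA, verbatim
  shape): now one-point links ARE excluded by the statement itself.  The non-vacuity OF RECORD remains
  `ex54ivInfKappaCompat_arith` + `exists_globInfk_infKappaLinkArith_not_mem_range` at the NAMED link (#346 (B)).

PROOF-ONLY: no `def`, no instance, no notation, no Prop fact, no `sorry`; axioms ⊆ {propext, Classical.choice,
Quot.sound}; C1 model presentation, COUNT-NEUTRAL (#316 (i)); typed/proved here ≠ proved-in-print ≠ tokened; nothing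
here asserts that abc is proved or refuted.
-/

namespace Literature.IUT.HodgeTheaters

open CriticalLocus

universe u v

/-! ### A one-point pseudo-monoid with non-empty domain realises only `1` -/

/-- If a partial multiplication on a one-point (subsingleton) carrier with NON-EMPTY domain is realised
([IUTchI] §0 p. 33) by `ι` in an abelian group, then `ι ≡ 1`: from `(pt, pt) ∈ dom` and `dom_eq`,
`ι pt · ι pt = ι pt`. ([IUTchI] Ex 5.4 (iv) p.149) [claim: Mochizuki2012, status: disputed] -/
theorem PartialMul.IsRealizedBy.apply_eq_one_of_subsingleton {P M : Type u} [CommGroup M] {μ : PartialMul P}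
    {ι : P → M} (h : μ.IsRealizedBy M ι) [Subsingleton P] (hd : μ.dom.Nonempty) (p : P) : ι p = 1 := by
  obtain ⟨q, hq⟩ := hd
  rw [h.dom_eq] at hq
  obtain ⟨r, hr⟩ := hq
  rw [Subsingleton.elim q.1 p, Subsingleton.elim q.2 p, Subsingleton.elim r p] at hr
  exact mul_eq_left.mp hr.symm

/-- Hence a pseudo-monoid with non-empty domain, realised in an abelian group with some value `≠ 1` (e.g. a value
outside the constants `F̄ ∋ 1`), has at least two points — the exclusion of one-point `∞κ`-links that the
strengthened non-vacuity corollary below builds in. ([IUTchI] Ex 5.4 (iv) p.149) [claim: Mochizuki2012, status: disputed] -/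
theorem PartialMul.IsRealizedBy.nontrivial_of_dom_nonempty {P M : Type u} [CommGroup M] {μ : PartialMul P}
    {ι : P → M} (h : μ.IsRealizedBy M ι) (hd : μ.dom.Nonempty) {m : P} (hm : ι m ≠ 1) : Nontrivial P := by
  by_contra hP
  rw [not_nontrivial_iff_subsingleton] at hP
  exact hm (h.apply_eq_one_of_subsingleton hd m)

/-! ### `1 ∈ 𝕄_{∞κ}` -/

/-- `1 ∈ 𝕄_{∞κ} ⊆ Λ_L` (the constant `1` is `κ`-coric, GB-01's `one_mem_infKappaCoricSetIn` read over the geometric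
constants `L̄` through `geomEmb`): the domain of the partial multiplication of `S.minfkCoricPair` contains `(1, 1)`.
([IUTchI] Rmk 3.1.7 (ii) p.67) [claim: Mochizuki2012, status: disputed] -/
theorem CriticalLocus.one_mem_minfkSet {L : Type u} [Field L] [CharZero L] (S : CriticalLocus L) :
    (1 : ratClosure L) ∈ S.minfkSet := by
  letI : Algebra (RatFunc (geomConstants L)) (ratClosure L) := (geomEmb L).toRingHom.toAlgebra
  exact S.toGeom.one_mem_infKappaCoricSetIn

/-! ### The strengthened non-vacuity corollary at the genuine initial Θ-data -/

section Datum

variable {F K Fbar : Type u} [Field F] [NumberField F] [Field K] [NumberField K]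
  [Algebra F K] [Field Fbar] [Algebra F Fbar] [Algebra K Fbar]
  {E : WeierstrassCurve F} [E.IsElliptic] {l : ℕ} {Pb : BadPlacePredicates K}
  (D : InitialThetaData F K Fbar E l Pb) (CG : D.geom.pe.CuspGalois) (hS : D.CuspClassesNormaliserStable) [Fact l.Prime]
  (M : D.TorsionMonodromy) (hA : D.geom.pe.ArrowCoveringClaims)
  (hI : ∀ k ∈ D.geom.pe.inertia D.geom.pe.ε1, M.tau (D.geom.embK k) = 0)
  (B : ∀ v, v ∈ D.indexCopyBad → D.BadPairAt v) (ΛBad : ∀ v (h : v ∈ D.indexCopyBad), D.LocalArrowLaw CG hS (B v h).H)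

namespace InitialThetaData

variable {Gv : D.IndexCopy → Subgroup (Fbar ≃ₐ[F] Fbar)}
  (ES : ∀ v, v ∈ D.indexCopyBad → EvalSectionBinder (D.localDataOfBadPairs CG hS M hA hI B ΛBad v) (Gv v))

/-- **NON-VACUITY COROLLARY, strengthened (spec-keeper B FILE-DELTA; RULINGS #346 (B), ERRATA-L5 I-128 cured)**:
over the stub of record there is an `∞κ`-link — the arithmetic knit `D.infKappaLinkArith` — at which [IUTchI]
Ex 5.4 (iv)'s `∞κ`-compatibility clause HOLDS and whose global pseudo-monoid `†𝕄^⊛_{∞κ}` has, for every `Z`,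
(i) NON-EMPTY partial multiplication (`(1, 1) ∈ dom`, `one_mem_minfkSet`), (ii) a REALISATION in `Λ_F^×`
([IUTchI] §0 p. 33, GB-01's `isRealizedBy_units_ofStableSet`) (iii) with a value OUTSIDE the constants `F̄`.  By
`PartialMul.IsRealizedBy.apply_eq_one_of_subsingleton`, (i)–(iii) together exclude every one-point link (in
particular ★ p514113's `PUnit` witness, whatever its domain).  C1 model presentation, count-neutral (#316 (i)); the
non-vacuity OF RECORD is `ex54ivInfKappaCompat_arith` + `exists_globInfk_infKappaLinkArith_not_mem_range`.
([IUTchI] Ex 5.4 (iv) p.149) [claim: Mochizuki2012, status: disputed] -/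
theorem exists_infKappaLink_ex54ivInfKappaCompat_arith' :
    ∃ L : (D.s5LocalThetaOfBadPairs CG hS M hA hI B ΛBad ES).InfKappaLink,
      BaseThetaDatum.S5Local.Ex54ivInfKappaCompat L ∧
      ∀ Z, letI := L.globRatGroup Z; letI := L.globRatTop Z
        (L.globInfk Z).pm.dom.Nonempty ∧
        ∃ ι : (L.globInfk Z).carrier → (ratClosure F)ˣ,
          (L.globInfk Z).pm.IsRealizedBy (ratClosure F)ˣ ι ∧
          ∃ m, ((ι m : (ratClosure F)ˣ) : ratClosure F) ∉
            Set.range (algebraMap (geomConstants F) (ratClosure F)) := by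
  refine ⟨D.infKappaLinkArith CG hS M hA hI B ΛBad ES, D.ex54ivInfKappaCompat_arith CG hS M hA hI B ΛBad ES,
    fun Z => ⟨?_, ?_⟩⟩
  · have h1 : (1 : ratClosure F) ∈ D.critLocus.minfkSet := D.critLocus.one_mem_minfkSet
    refine ⟨((⟨1, h1⟩ : D.critLocus.minfkCoricPair.carrier), (⟨1, h1⟩ : D.critLocus.minfkCoricPair.carrier)), ?_⟩
    show (1 : ratClosure F) * 1 ∈ D.critLocus.minfkSet
    rw [mul_one]
    exact h1
  · have h0 : (0 : ratClosure F) ∉ D.critLocus.minfkSet := D.critLocus.zero_notMem_minfkSet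
    obtain ⟨m, hm⟩ := D.exists_globInfk_infKappaLinkArith_not_mem_range CG hS M hA hI B ΛBad ES Z
    exact ⟨fun x : D.critLocus.minfkCoricPair.carrier =>
        Units.mk0 (x : ratClosure F) (CoricPair.coe_ne_zero_of_zero_notMem h0 x),
      CoricPair.isRealizedBy_units_ofStableSet h0, m, hm⟩

end InitialThetaData

end Datum

end Literature.IUT.HodgeTheaters
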